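import Summits.KontsevichZagierPeriods.KontsevichZagierPeriods.Theses.FurushoPentagon
import Summits.KontsevichZagierPeriods.KontsevichZagierPeriods.Theorems.FurushoPentagonStuffleInKZ
import Summits.KontsevichZagierPeriods.KontsevichZagierPeriods.Theorems.FurushoPentagonHoffmanRelationInKZ
import Summits.KontsevichZagierPeriods.KontsevichZagierPeriods.Theorems.FurushoPentagonKernelImpliesReduced
import Summits.KontsevichZagierPeriods.KontsevichZagierPeriods.Theorems.PentagonInKZ.Negative.KernelImplies
import Summits.KontsevichZagierPeriods.KontsevichZagierPeriods.Theorems.FurushoPentagonKernelModuloPeriodConjectureFormalHoffmanSpan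
import Summits.KontsevichZagierPeriods.KontsevichZagierPeriods.Theorems.FurushoPentagonKernelModuloPeriodConjectureSectorKernelOfFormalSpan
import Summits.KontsevichZagierPeriods.KontsevichZagierPeriods.Theorems.ReducedPeriodRing.Negative.RingForms
import Literature.NumberTheory.Transcendental.KZKernelConjectureForms
import Literature.NumberTheory.Transcendental.MultipleZetaValues
import Literature.NumberTheory.Transcendental.AssociatorsPentagonWeightTwo
import Literature.NumberTheory.Transcendental.DrinfeldAssociatorRegularisation
import Literature.NumberTheory.Transcendental.DrinfeldAssociatorPentagonProofs
import Literature.NumberTheory.Transcendental.DrinfeldAssociatorIsGroupLikeProofs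
import Literature.NumberTheory.Transcendental.MultipleZetaProofs
import Literature.NumberTheory.Transcendental.MultipleZetaWeightFiveProofs
import Literature.NumberTheory.Transcendental.MultipleZetaValuesHoffmanProofs

/-!
# Disproof of `KernelModuloPeriodConjecture` (crux stmt-KontsevichZagierPeriods-15058) — findings

Standing adversary file of the crux disprover (route FurushoPentagon, rev 20; line `Sketch` picked by
the lead, `Cruxes/KernelModuloPeriodConjecture/Lines/Sketch.lean`). Everything below is `sorry`-free;
prose only in docstrings. Sibling file honoured and not repeated: `Cruxes/SectorToKernel/Disproof.lean`
(crux 10813 = this crux's conclusion; its §6 "kernel form false for every proper sub-calculus" and §7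
"transcendence-hard relative to the hypotheses" apply verbatim to the conclusion here).

The crux is the DECLARED REMAINDER of the route,

  `KernelModuloPeriodConjecture : MzvPeriodConjecture → PentagonInKZ → ReducedPeriodRing → SectorToKernel`,

`SectorToKernel := StuffleInKZ → HoffmanRelationInKZ → ∀ c, KZ.eval c = 0 → c ∈ KZ.relations`.

**VERDICT (cycle 1): NO KILL, and no unconditional kill can exist short of (a PROOF of the period
conjecture for `MT(ℤ)` in Hoffman form) + (a proof of `PentagonInKZ`) + (a proof of
`ReducedPeriodRing`) + (a DISPROOF of the summit `KontsevichZagierPeriods`)** — `not_iff_summit`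
below is the exact statement. The first conjunct alone (`mzvPeriodConjecture_of_not`) is open
transcendence (weight 5 already asks `ζ(5) ∉ ℚ ζ(2)ζ(3)`), the last conjunct is route Neg's thesis.

## Index

* §0 UNFOLDING. The inner antecedents `StuffleInKZ`, `HoffmanRelationInKZ` are tree theorems
  (`StuffleInKZ_of`, `hoffmanRelationInKZ_proof`), so `SectorToKernel ↔ KernelForm`
  (`sectorToKernel_iff_kernelForm`) and the crux is `Z → P → R → KernelForm` (`iff_kernelForm`);
  `KernelForm` is the summit (`kernelForm_iff_summit`, tree `kzKernelConjecture_iff_isRational`),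
  hence `iff_summit : crux ↔ (Z → P → R → KontsevichZagierPeriods)`.
* §1 WHAT PROVES THE CRUX: the summit (`of_summit`), the conclusion (`of_kernelForm`), crux 10813
  (`of_sectorToKernel`), the bare implication `Z → summit` (`of_imp`), and the three VACUITY ESCAPES
  `of_not_mzvPeriodConjecture`, `of_not_pentagonInKZ`, `of_not_reducedPeriodRing` — the last two are
  themselves disproofs of the summit (`not_summit_of_not_pentagonInKZ`, tree; `not_summit_of_not_reduced`).
* §2 TWO ANTECEDENTS ARE OUTPUTS OF THE CONCLUSION: `KernelForm → PentagonInKZ ∧ ReducedPeriodRing`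
  (`mechanism_of_kernelForm`: tree `pentagonInKZ_of_kernel` = Drinfeld's theorem reflected along
  `P_eff ↪ ℝ`, and `kernelImpliesReduced_proof`). `MzvPeriodConjecture` is NOT (in-tree) an output of
  the conclusion: it is the genuinely independent, transcendental input.
* §3 ANATOMY: `iff_or : crux ↔ (Z → summit) ∨ ¬P ∨ ¬R`; `not_iff_summit : ¬crux ↔ Z ∧ P ∧ R ∧ ¬summit`;
  `mzvPeriodConjecture_of_not`, `not_summit_of_not`; `iff_summit_of_hyps` (once Z, P, R are granted
  the item IS Conjecture 1). CONSEQUENCE: every refutation of this crux is simultaneously (i) a proof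
  of the period conjecture for MT(ℤ) on the Hoffman MZVs and (ii) a disproof of the Kontsevich–Zagier
  conjecture for the tree's calculus. Neither half is available; no `Refutation.lean` can be filed.
* §4 LOAD-BEARING ANALYSIS of the crux's own hypotheses: `WithoutZ` (= the retired rev-15 item
  SectorToKernelOfPentagon, stmt-14829), `WithoutP`, `WithoutR`, `WithoutAll` (= crux 10813); each
  `¬Without*` is equivalent to a conjunction containing `¬KontsevichZagierPeriods`
  (`not_withoutZ_iff`, `not_withoutP_iff`, `not_withoutR_iff`, `not_withoutAll_iff`), so NO
  `_false_without_` theorem exists for any hypothesis unless Conjecture 1 is false: P and R carry no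
  weight at all (outputs of the conclusion, §2); Z carries exactly the weight "Conjecture 1 for
  non-MZV periods does not follow from Conjecture 1"— i.e. none that a counterexample can cash.
* §5 LINE `Sketch` (lead's skeleton v2: stubs T = `stub_mzvSectorTransfer` LANDED, A =
  `stub_associatorHoffmanSpanning` OPEN, O = `stub_offMzvSectorComplement` NOT CLAIMED).
  - JOINT SUFFICIENCY holds by name, no smuggled gap: `crux_of_stubs : StubA → StubO → crux` through
    the landed T (`stub_mzvSectorTransfer`).
  - STUB O (`StubO := MzvSectorKernel → KernelForm`): summit-implied (`stubO_of_summit`), its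
    antecedent is summit-implied (`mzvSectorKernel_of_kernelForm`), and `¬StubO ↔ MzvSectorKernel ∧
    ¬summit` (`not_stubO_iff`): unkillable short of ¬Conjecture 1 with the MZV sector intact. It is
    Conjecture 1 off the sector, honestly NOT CLAIMED.
  - STUB A (`StubA`, the algebraic leaf = planner's child AssociatorHoffmanSpanning): NOT
    summit-implied — it quantifies over ALL group-like pentagon solutions over all reduced ℚ-algebras
    (the GRT side), so THE LINE CAN DIE WITHOUT THE CRUX DYING: ¬A ⟺ in some weight k the Hoffman
    coefficient functionals fail to span `𝒪(GroupLike ∩ Pent)_red,k`, i.e. `dim > d_k`, i.e.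
    `𝔤𝔯𝔱₁ ⊋ 𝔤^𝔪` in weight k (Drinfeld–Ihara–Deligne territory; excluded wherever `𝔡𝔪𝔯₀` has been
    computed, k ≲ 20). DIMENSION COUNT making this precise: with `M = {(μ,φ)}` Drinfeld's associator
    space, `M ≅ GRT₁ × 𝔸¹_μ` (torsor trivialised by a rational associator rescaled, `μ` of weight 1)
    and Furusho 2010 (pentagon ⇒ hexagons for `μ = ±√(24 c_{X₀X₁})`) give
    `𝒪(GroupLike ∩ Pent)_red = 𝒪(M)^{μ ↦ −μ}`, so `Σ_k dim_k t^k = G(t)/(1−t²)` with `G` the Poincaré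
    series of `U(𝔤𝔯𝔱₁)^∨`; Brown's `𝔤^𝔪 ↪ 𝔤𝔯𝔱₁` gives `G(t) ≥ (1−t²)/(1−t²−t³)` coefficientwise, i.e.
    `dim_k ≥ d_k`, with equality in all weights iff `𝔤𝔯𝔱₁ = 𝔤^𝔪`; and the Hoffman functionals are
    independent on the scheme (already at the motivic associator, Brown 2012). Hence
    A ⟺ `𝔤𝔯𝔱₁ = 𝔤^𝔪` (Drinfeld's conjecture), weight by weight — OPEN, believed true, a theorem in
    every weight where `dim 𝔡𝔪𝔯₀` has been computed (`𝔤^𝔪 ⊆ 𝔤𝔯𝔱₁ ⊆ 𝔡𝔪𝔯₀`). No cheap kill.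
    What the transfer T actually consumes is only its value at ONE point, the
    rules associator over `P_ℚ` ("formal Hoffman spanning", G1's consequent) — and THAT is
    summit-implied given Brown's theorem: `formalHoffmanSpan_of_summit` (kernel form ⇒ `evalPQ`
    injective, `evalPQ_injective_of_kernelForm`; a real Hoffman expansion lifts), whereas A implies
    Brown's theorem (`hoffmanSpan_eq_mzvSpace_of_stubA`) and is not summit-implied.
    HARDNESS: `multipleZeta_mem_hoffmanSpan_of_stubA` — A evaluated at the tree's real Drinfeld
    associator (`drinfeldAssociator`, group-like and a pentagon solution by the tree theorems
    `drinfeldAssociator_isGroupLike_holds`, `drinfeldAssociator_pentagon_holds`) IS Brown's theorem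
    "Hoffman elements span all MZVs" (Brown 2012 Thm 1.1, spanning half; tree named fact
    `hoffmanSpan_eq_mzvSpace`, unproved): any proof of A reproves Brown's theorem with a uniform
    (motivic-Galois-equivariant) certificate. Consistency: A holds in weight ≤ 4 (tree,
    `associatorHoffmanSpanning_of_weight_le_four`).
    MUTATIONS (small-model refutations of natural strengthenings / weakenings of hypotheses):
    `stubA_false_without_pentagon` (drop the pentagon: witnesses `exp(X₀)exp(X₁)`, `exp(X₀)exp(2X₁)`
    over ℚ at s = (2,1) — the pentagon is load-bearing already in weight 3);
    `not_stubAIntegral` (ℤ-coefficients impossible: at s = (4) the pentagon forces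
    `3 c_{(4)} = −4 c_{(2,2)}` and `c_{(2,2)}(Φ_KZ) = ζ(2,2) > 0` — so the passage to `P_ℚ` and the
    proved `IntegerDivision` in T are NECESSARY, not an artefact);
    `not_stubADepthCompatible` (no depth-non-increasing Hoffman reduction: s = (4) has depth 1, the
    only weight-4 Hoffman index (2,2) has depth 2, and `c_{(4)}(Φ_KZ) = −ζ(4) ≠ 0` — relevant to the
    competing depth-graded idea `ls-depth-graded-squeeze`: Hoffman reduction is not depth-filtered).
    OPEN MUTATIONS (no witness found, recorded as `def`s): `StubAWithoutReduced` (is the scheme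
    `GroupLike ∩ Pent` reduced? unknown in print; a first-order deformation `Φ + εD` over `ℝ[ε]/ε²`
    violating a Hoffman reduction would be a nilpotent obstruction), `StubAWithoutGroupLike` (the only
    non-group-like pentagon solutions over reduced rings found are idempotent constants, which satisfy
    every homogeneous reduction).
* §6 TRANSCENDENCE POSITIONING: `mzvPeriodConjecture_of_not` + the sibling's §7: a refuter can only
  return here holding the MT(ℤ) period conjecture — concretely `irrational_multipleZeta_five_of_not`:
  a refutation of this crux proves `ζ(5) ∉ ℚ` (via the tree's `5ζ(5) = 4ζ(3,2) + 6ζ(2,3)`); the barrier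
  `Literature.Barriers.KontsevichZagierPeriods.kzConjecture_implies_oddZetaAlgIndep` is not evaded by
  the crux, the crux's antecedent Z sits INSIDE the barrier's conclusion.

## Landed under `Theorems/KernelModuloPeriodConjecture/Negative/` (this unit; import them rather than this file)
* `Anatomy.lean` — p99338 ACCEPTED: §0–§4 of this file (`iff_summit`, `iff_or`, `not_iff_summit`,
  `not_without{Z,P,R,All}_iff`, `hoffman_injective_of_not`, …).
* `StubAFalseWithoutPentagon.lean` — p99359 ACCEPTED: `stubA_false_without_pentagon`, `expXexpY`,
  `weightThree_reduction_of_pentagon`.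
* `StubAImpliesBrownSpanning.lean` — p99370 ACCEPTED: `multipleZeta_mem_hoffmanSpan_of_stubA`,
  `hoffmanSpan_eq_mzvSpace_of_stubA`.
* `StubANoIntegralNoDepthForm.lean` — p100578 ACCEPTED (after p99364 bounced on a duplicated helper, now the
  tree's `MZV.eq_of_isHoffman_of_weight_eq_four`): `not_stubAIntegral`, `not_stubADepthCompatible`,
  `pentagon_weight_four_ratio`, `drinfeldAssociator_xyxy_pos`, `drinfeldAssociator_xxxy_ne_zero`.
* `FormalHoffmanSpanOfSummit.lean` — p99721 ACCEPTED: `exists_inv_nat_tmul`, `evalPQ_injective_of_kernelForm`,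
  `formalHoffmanSpan_of_kernelForm`, `formalHoffmanSpan_of_summit`.
* `ZetaFiveOfRefutation.lean` — p100045 ACCEPTED: `irrational_multipleZeta_five_of_mzvPeriodConjecture`,
  `irrational_multipleZeta_five_of_not_kernelModuloPeriodConjecture`.

## Junk hunt (no finding; recorded so nobody repeats it)
`MzvPeriodConjecture` is `LinearIndependent ℚ (u : {u // IsHoffman u}) ↦ multipleZeta u`: Hoffman
indices are admissible (`IsHoffman.isAdmissible`), so every `multipleZeta u` is the genuine convergent
sum (no `tsum` junk), `u = []` gives `ζ(∅) = 1` (intended: weight 0, `d₀ = 1`); distinct Hoffman lists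
are not provably equal-valued; the statement is neither provable nor refutable in-tree (open
transcendence). `PentagonInKZ`, `ReducedPeriodRing` are summit-implied (§2), so not junk-false unless
the summit is. The conclusion's calculus was junk-hunted by the sibling (null/empty domains, off-domain
integrands, dimension 0, `a ≤ b` in Newton–Leibniz): nothing.

## Prover / planner briefing
Do not staff the crux as a whole (the route already says NOT CLAIMED). For the line: T is done; O is
Conjecture 1 off the sector; A is the only place where work can land, and A is strictly stronger than
what T needs — if A stalls, the honest rules-side residual is "Hoffman classes span the MZV sector of
`P_ℚ`" (G1's consequent), which is summit-implied given Brown's theorem, whereas A is not. Per-weight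
slices of A (weight 5, 6: `d₅ = d₆ = 2`) are finite linear algebra over the tree's double-shuffle
consequences of the pentagon (`NCSeries.DrinfeldPentagon.generalisedDoubleShuffle`, any commutative
ℚ-algebra) and are the natural next theorem-grade stubs; by `not_stubAIntegral` their certificates
have genuine denominators (weight 4: 3 ∣ denominators). EXPECTED WEIGHT-5 CERTIFICATES (data for that
stub, from the regularised double shuffle + duality in weight 5, checked numerically to 9 digits against
`ζ(5) = 1.036927755`, `ζ(2,3) = 0.711566198`, `ζ(3,2) = 0.228810397`, `ζ(4,1) = 0.096551160`; convention
`c_{binaryWord s} = (−1)^{depth s} ζ(s)`, Hoffman targets `H₁ = (2,3)`, `H₂ = (3,2)`, so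
`b_t = (−1)^{depth s} · [coefficient of ζ(t) in ζ(s)]`):
`(5) ↦ (−6/5, −4/5)`, `(4,1) ↦ (1/5, −1/5)`, `(3,1,1) ↦ (−1/5, 1/5)` (dual of (4,1)),
`(2,2,1) ↦ (0, −1)` (dual of (3,2)), `(2,1,2) ↦ (−1, 0)` (dual of (2,3)), `(2,1,1,1) ↦ (6/5, 4/5)` (dual
of (5)); i.e. `ζ(5) = (6ζ(2,3) + 4ζ(3,2))/5`, `ζ(2)ζ(3) = (11ζ(2,3) + 9ζ(3,2))/5`, `ζ(4,1) = (ζ(2,3) −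
ζ(3,2))/5`. Denominator 5 in weight 5 (3 in weight 4): no integral form, as `not_stubAIntegral` predicts.
-/

noncomputable section

set_option linter.dupNamespace false

namespace Summit.KontsevichZagierPeriods.KontsevichZagierPeriods.Cruxes.KernelModuloPeriodConjecture.Disproof

open Literature.NumberTheory.Transcendental
open Literature.NumberTheory.Transcendental.KZ
open Summit.KontsevichZagierPeriods.KontsevichZagierPeriods.Theses.FurushoPentagon

open Summit.KontsevichZagierPeriods.FurushoPentagon (kernelImpliesReduced_proof)
open Summit.KontsevichZagierPeriods.FurushoPentagon.StuffleInKZ (StuffleInKZ_of)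
open Summit.KontsevichZagierPeriods.FurushoPentagon.HoffmanRelationInKZ (hoffmanRelationInKZ_proof)
open Summit.KontsevichZagierPeriods.FurushoPentagon.PentagonInKZNegative (pentagonInKZ_of_summit
  pentagonInKZ_of_kernel not_summit_of_not_pentagonInKZ)
open Summit.KontsevichZagierPeriods.FurushoPentagon.KernelModuloPeriodConjecture (stub_formalHoffmanSpan
  stub_sectorKernelOfFormalSpan)
open Summit.KontsevichZagierPeriods.KontsevichZagierPeriods.ReducedPeriodRingNegative
  (kzKernelConjecture_iff_injective_evalP)
open scoped TensorProduct

/-! ## §0 Unfolding -/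

/-- The kernel form of Conjecture 1 — the crux's final conclusion, written out. -/
abbrev KernelForm : Prop := ∀ c : FormalRep, eval c = 0 → c ∈ relations

/-- The conclusion is VERBATIM the tree's conjecture leaf `KZKernelConjecture`. [folklore] -/
theorem kernelForm_iff_kzKernelConjecture : KernelForm ↔ KZKernelConjecture := Iff.rfl

/-- **The conclusion is the summit** (tree theorem `kzKernelConjecture_iff_isRational` composed with the
definitional unfolding `KontsevichZagierPeriods_iff`). [folklore] -/
theorem kernelForm_iff_summit : KernelForm ↔ KontsevichZagierPeriods :=
  kzKernelConjecture_iff_isRational.trans KontsevichZagierPeriods_iff.symm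

/-- Unfolding of the crux (definitional). [folklore] -/
theorem iff_chain :
    KernelModuloPeriodConjecture ↔
      (MzvPeriodConjecture → PentagonInKZ → ReducedPeriodRing → SectorToKernel) := Iff.rfl

/-- **The inner antecedents are theorems**: `SectorToKernel ↔ KernelForm` (tree theorems `StuffleInKZ_of`,
`hoffmanRelationInKZ_proof`). [folklore] -/
theorem sectorToKernel_iff_kernelForm : SectorToKernel ↔ KernelForm :=
  ⟨fun h => h StuffleInKZ_of hoffmanRelationInKZ_proof, fun h _ _ => h⟩

/-- **The crux is `Z → P → R → KernelForm`.** [folklore] -/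
theorem iff_kernelForm :
    KernelModuloPeriodConjecture ↔
      (MzvPeriodConjecture → PentagonInKZ → ReducedPeriodRing → KernelForm) :=
  imp_congr_right fun _ => imp_congr_right fun _ => imp_congr_right fun _ =>
    sectorToKernel_iff_kernelForm

/-- **The crux is `Z → P → R → Conjecture 1`.** [folklore] -/
theorem iff_summit :
    KernelModuloPeriodConjecture ↔
      (MzvPeriodConjecture → PentagonInKZ → ReducedPeriodRing → KontsevichZagierPeriods) :=
  iff_kernelForm.trans
    (imp_congr_right fun _ => imp_congr_right fun _ => imp_congr_right fun _ => kernelForm_iff_summit)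

/-! ## §1 What proves the crux -/

/-- `KernelForm ⇒ crux` (no antecedent is used). [folklore] -/
theorem of_kernelForm (h : KernelForm) : KernelModuloPeriodConjecture := fun _ _ _ _ _ => h

/-- `summit ⇒ crux`: the crux is summit-implied (it is NOT stronger than Conjecture 1). [folklore] -/
theorem of_summit (h : KontsevichZagierPeriods) : KernelModuloPeriodConjecture :=
  of_kernelForm (kernelForm_iff_summit.mpr h)

/-- `SectorToKernel ⇒ crux` (crux 10813 closes this one as a by-product). [folklore] -/
theorem of_sectorToKernel (h : SectorToKernel) : KernelModuloPeriodConjecture := fun _ _ _ => h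

/-- `(Z → Conjecture 1) ⇒ crux`: the bare transcendence-to-periods implication suffices. [folklore] -/
theorem of_imp (h : MzvPeriodConjecture → KontsevichZagierPeriods) : KernelModuloPeriodConjecture :=
  fun hZ _ _ => sectorToKernel_iff_kernelForm.mpr (kernelForm_iff_summit.mpr (h hZ))

/-- Vacuity escape 1: a DISPROOF of the period conjecture for `MT(ℤ)` (Hoffman form) proves the crux.
[folklore] -/
theorem of_not_mzvPeriodConjecture (h : ¬ MzvPeriodConjecture) : KernelModuloPeriodConjecture :=
  fun hZ => absurd hZ h

/-- Vacuity escape 2: `¬PentagonInKZ` proves the crux … [folklore] -/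
theorem of_not_pentagonInKZ (h : ¬ PentagonInKZ) : KernelModuloPeriodConjecture :=
  fun _ hP => absurd hP h

/-- … and refutes the summit (tree: `not_summit_of_not_pentagonInKZ`). [folklore] -/
theorem not_summit_of_not_pentagonInKZ' (h : ¬ PentagonInKZ) : ¬ KontsevichZagierPeriods :=
  not_summit_of_not_pentagonInKZ h

/-- Vacuity escape 3: `¬ReducedPeriodRing` proves the crux … [folklore] -/
theorem of_not_reducedPeriodRing (h : ¬ ReducedPeriodRing) : KernelModuloPeriodConjecture :=
  fun _ _ hR => absurd hR h

/-- … and refutes the summit (`kernelImpliesReduced_proof`). [folklore] -/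
theorem not_summit_of_not_reduced (h : ¬ ReducedPeriodRing) : ¬ KontsevichZagierPeriods :=
  fun hs => h (kernelImpliesReduced_proof (kernelForm_iff_summit.mpr hs))

/-! ## §2 The mechanism antecedents are outputs of the conclusion -/

/-- **`KernelForm ⇒ PentagonInKZ ∧ ReducedPeriodRing`** (tree: `pentagonInKZ_of_kernel` — Drinfeld's
theorem `drinfeldAssociator_pentagon_holds` reflected along the value algebra `P_eff ↪ ℝ` — and
`kernelImpliesReduced_proof`). [folklore] -/
theorem mechanism_of_kernelForm (h : KernelForm) : PentagonInKZ ∧ ReducedPeriodRing :=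
  ⟨pentagonInKZ_of_kernel h, kernelImpliesReduced_proof h⟩

/-- The same from the summit. [folklore] -/
theorem mechanism_of_summit (h : KontsevichZagierPeriods) : PentagonInKZ ∧ ReducedPeriodRing :=
  mechanism_of_kernelForm (kernelForm_iff_summit.mpr h)

/-! ## §3 Anatomy: what a proof and what a refutation of the crux are -/

/-- **`crux ↔ (Z → summit) ∨ ¬P ∨ ¬R`.** [folklore] -/
theorem iff_or :
    KernelModuloPeriodConjecture ↔
      ((MzvPeriodConjecture → KontsevichZagierPeriods) ∨ ¬ PentagonInKZ ∨ ¬ ReducedPeriodRing) := by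
  rw [iff_summit]
  constructor
  · intro h
    by_cases hP : PentagonInKZ
    · by_cases hR : ReducedPeriodRing
      · exact Or.inl fun hZ => h hZ hP hR
      · exact Or.inr (Or.inr hR)
    · exact Or.inr (Or.inl hP)
  · rintro (h | h | h) hZ hP hR
    · exact h hZ
    · exact absurd hP h
    · exact absurd hR h

/-- **`¬crux ↔ Z ∧ P ∧ R ∧ ¬KernelForm`.** [folklore] -/
theorem not_iff :
    ¬ KernelModuloPeriodConjecture ↔
      (MzvPeriodConjecture ∧ PentagonInKZ ∧ ReducedPeriodRing ∧ ¬ KernelForm) := by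
  rw [iff_kernelForm]
  constructor
  · intro h
    by_contra h'
    exact h fun hZ hP hR => by_contra fun hK => h' ⟨hZ, hP, hR, hK⟩
  · rintro ⟨hZ, hP, hR, hK⟩ h
    exact hK (h hZ hP hR)

/-- **`¬crux ↔ Z ∧ P ∧ R ∧ ¬summit`**: a refutation is a proof of the MT(ℤ) period conjecture (Hoffman
form) AND of the two mechanism cruxes AND a disproof of Conjecture 1. [folklore] -/
theorem not_iff_summit :
    ¬ KernelModuloPeriodConjecture ↔
      (MzvPeriodConjecture ∧ PentagonInKZ ∧ ReducedPeriodRing ∧ ¬ KontsevichZagierPeriods) := by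
  rw [not_iff, kernelForm_iff_summit]

/-- **Any refutation proves the period conjecture for `MT(ℤ)` on the Hoffman MZVs.** [folklore] -/
theorem mzvPeriodConjecture_of_not (h : ¬ KernelModuloPeriodConjecture) : MzvPeriodConjecture :=
  (not_iff_summit.mp h).1

/-- **Any refutation refutes the summit.** [folklore] -/
theorem not_summit_of_not (h : ¬ KernelModuloPeriodConjecture) : ¬ KontsevichZagierPeriods :=
  (not_iff_summit.mp h).2.2.2

/-- Once the three antecedents are granted, the item IS Conjecture 1. [folklore] -/
theorem iff_summit_of_hyps (hZ : MzvPeriodConjecture) (hP : PentagonInKZ) (hR : ReducedPeriodRing) :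
    KernelModuloPeriodConjecture ↔ KontsevichZagierPeriods :=
  ⟨fun h => kernelForm_iff_summit.mp (sectorToKernel_iff_kernelForm.mp (h hZ hP hR)),
    fun h => of_summit h⟩

/-- A proof of the crux together with Z, P, R is a proof of Conjecture 1. [folklore] -/
theorem summit_of_proof (h : KernelModuloPeriodConjecture) (hZ : MzvPeriodConjecture)
    (hP : PentagonInKZ) (hR : ReducedPeriodRing) : KontsevichZagierPeriods :=
  (iff_summit_of_hyps hZ hP hR).mp h

/-- The dichotomy a proof of the crux leaves: either it closed Conjecture 1 from Z, or the world has
`¬P ∨ ¬R` (hence `¬summit`). [folklore] -/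
theorem cases_of_proof (h : KernelModuloPeriodConjecture) :
    (MzvPeriodConjecture → KontsevichZagierPeriods) ∨ ¬ KontsevichZagierPeriods := by
  rcases iff_or.mp h with h | h | h
  · exact Or.inl h
  · exact Or.inr (not_summit_of_not_pentagonInKZ h)
  · exact Or.inr (not_summit_of_not_reduced h)

/-- Shape of a counterexample: an element of `ker eval ∖ relations` (plus proofs of Z, P, R). [folklore] -/
theorem counterexample_shape (h : ¬ KernelModuloPeriodConjecture) :
    MzvPeriodConjecture ∧ ∃ c : FormalRep, eval c = 0 ∧ c ∉ relations := by
  obtain ⟨hZ, -, -, hK⟩ := not_iff.mp h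
  refine ⟨hZ, ?_⟩
  by_contra h'
  push Not at h'
  exact hK fun c hc => h' c hc

/-! ## §4 Load-bearing analysis of the crux's hypotheses: no `_false_without_` theorem exists -/

/-- The crux with `MzvPeriodConjecture` dropped (= the retired rev-15 item `SectorToKernelOfPentagon`,
stmt-14829). -/
def WithoutZ : Prop := PentagonInKZ → ReducedPeriodRing → SectorToKernel

/-- The crux with `PentagonInKZ` dropped. -/
def WithoutP : Prop := MzvPeriodConjecture → ReducedPeriodRing → SectorToKernel

/-- The crux with `ReducedPeriodRing` dropped. -/
def WithoutR : Prop := MzvPeriodConjecture → PentagonInKZ → SectorToKernel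

/-- The crux with all three antecedents dropped (= crux `SectorToKernel`, stmt-10813). -/
def WithoutAll : Prop := SectorToKernel

/-- The chain of strengthenings `WithoutAll → WithoutZ → crux`, `WithoutAll → WithoutP → crux`,
`WithoutAll → WithoutR → crux`. [folklore] -/
theorem chain :
    (WithoutAll → WithoutZ) ∧ (WithoutZ → KernelModuloPeriodConjecture) ∧
    (WithoutAll → WithoutP) ∧ (WithoutP → KernelModuloPeriodConjecture) ∧
    (WithoutAll → WithoutR) ∧ (WithoutR → KernelModuloPeriodConjecture) :=
  ⟨fun h _ _ => h, fun h _ => h, fun h _ _ => h, fun h hZ _ hR => h hZ hR,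
    fun h _ _ => h, fun h hZ hP _ => h hZ hP⟩

/-- `¬WithoutAll ↔ ¬summit`. [folklore] -/
theorem not_withoutAll_iff : ¬ WithoutAll ↔ ¬ KontsevichZagierPeriods :=
  not_congr (sectorToKernel_iff_kernelForm.trans kernelForm_iff_summit)

/-- `¬WithoutZ ↔ P ∧ R ∧ ¬summit`: a `_false_without_Z` theorem needs a disproof of Conjecture 1
(and proofs of both mechanism cruxes). [folklore] -/
theorem not_withoutZ_iff :
    ¬ WithoutZ ↔ (PentagonInKZ ∧ ReducedPeriodRing ∧ ¬ KontsevichZagierPeriods) := by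
  unfold WithoutZ
  rw [sectorToKernel_iff_kernelForm, kernelForm_iff_summit]
  constructor
  · intro h
    by_contra h'
    exact h fun hP hR => by_contra fun hK => h' ⟨hP, hR, hK⟩
  · rintro ⟨hP, hR, hK⟩ h
    exact hK (h hP hR)

/-- `¬WithoutP ↔ Z ∧ R ∧ ¬summit`. [folklore] -/
theorem not_withoutP_iff :
    ¬ WithoutP ↔ (MzvPeriodConjecture ∧ ReducedPeriodRing ∧ ¬ KontsevichZagierPeriods) := by
  unfold WithoutP
  rw [sectorToKernel_iff_kernelForm, kernelForm_iff_summit]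
  constructor
  · intro h
    by_contra h'
    exact h fun hZ hR => by_contra fun hK => h' ⟨hZ, hR, hK⟩
  · rintro ⟨hZ, hR, hK⟩ h
    exact hK (h hZ hR)

/-- `¬WithoutR ↔ Z ∧ P ∧ ¬summit`. [folklore] -/
theorem not_withoutR_iff :
    ¬ WithoutR ↔ (MzvPeriodConjecture ∧ PentagonInKZ ∧ ¬ KontsevichZagierPeriods) := by
  unfold WithoutR
  rw [sectorToKernel_iff_kernelForm, kernelForm_iff_summit]
  constructor
  · intro h
    by_contra h'
    exact h fun hZ hP => by_contra fun hK => h' ⟨hZ, hP, hK⟩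
  · rintro ⟨hZ, hP, hK⟩ h
    exact hK (h hZ hP)

/-- So every hypothesis-drop can only be refuted by refuting Conjecture 1. [folklore] -/
theorem not_summit_of_not_without
    (h : ¬ WithoutZ ∨ ¬ WithoutP ∨ ¬ WithoutR ∨ ¬ WithoutAll) : ¬ KontsevichZagierPeriods := by
  rcases h with h | h | h | h
  · exact (not_withoutZ_iff.mp h).2.2
  · exact (not_withoutP_iff.mp h).2.2
  · exact (not_withoutR_iff.mp h).2.2
  · exact not_withoutAll_iff.mp h

/-! ## §5 Line `Sketch` — targets: the stubs A, O and their joint sufficiency -/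

/-- **Stub A** of line `Sketch` = the planner's child `AssociatorHoffmanSpanning`, verbatim. -/
abbrev StubA : Prop :=
  ∀ s : List ℕ, MZV.IsAdmissible s → ∃ b : List ℕ →₀ ℚ,
    (∀ t ∈ b.support, MZV.IsHoffman t ∧ MZV.weight t = MZV.weight s) ∧
    ∀ (R : Type) [CommRing R] [Algebra ℚ R] [IsReduced R] (φ : NCSeries Bool R),
      NCSeries.IsGroupLike φ → NCSeries.DrinfeldPentagon φ →
        φ (MZV.binaryWord s) = b.sum (fun t q => q • φ (MZV.binaryWord t))

/-- Conjecture 1 in kernel form ON THE MZV SECTOR (the antecedent of stub O, the conclusion of stub T). -/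
abbrev MzvSectorKernel : Prop :=
  ∀ c ∈ AddSubgroup.closure (Set.range (fun s : {s : List ℕ // MZV.IsAdmissible s} =>
    KZ.of (KZ.mzvRep s.1 s.2 (KZ.mzvIntegrand_isSemialgebraicFunOn_holds s.1)
      (KZ.mzvIntegrand_integrableOn_holds s.1 s.2)))), KZ.eval c = 0 → c ∈ KZ.relations

/-- **Stub O** of line `Sketch` = the planner's child `OffMzvSectorComplement`, verbatim. -/
abbrev StubO : Prop := MzvSectorKernel → KernelForm

/-- **Formal Hoffman spanning** in `P_ℚ = ℚ ⊗ (FormalRep ⧸ relations)`: the consequent of the landed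
G1 (`stub_formalHoffmanSpan`) and the antecedent of the landed G2 (`stub_sectorKernelOfFormalSpan`) —
the ONLY thing the transfer consumes from stub A (A read at one point, the rules associator). -/
abbrev FormalHoffmanSpan : Prop :=
  ∀ s : List ℕ, MZV.IsAdmissible s → KZ.toPeriodAlgebra (KZ.mzvClass s) ∈
    Submodule.span ℚ (Set.range (fun t : {t : List ℕ // MZV.IsHoffman t} =>
      KZ.toPeriodAlgebra (KZ.mzvClass t.1)))

/-- **Stub T** (the MZV-sector transfer) as the composition of the two LANDED glue stubs G2 ∘ G1
(tree: `stub_formalHoffmanSpan`, p96287; `stub_sectorKernelOfFormalSpan`, p96442; the lead's v2 file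
`…MzvSectorTransfer.lean` records the same composition). [cite: Furusho2011, Thm 1.2] -/
theorem transfer (hP : PentagonInKZ) (hR : ReducedPeriodRing) (hA : StubA) (hZ : MzvPeriodConjecture) :
    MzvSectorKernel :=
  stub_sectorKernelOfFormalSpan (stub_formalHoffmanSpan hP hR hA) hZ

/-- G1 restated: `P ∧ R ∧ A ⇒ FormalHoffmanSpan`. [cite: Furusho2011, Thm 1.2] -/
theorem formalHoffmanSpan_of_stubA (hP : PentagonInKZ) (hR : ReducedPeriodRing) (hA : StubA) :
    FormalHoffmanSpan :=
  stub_formalHoffmanSpan hP hR hA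

/-- G2 restated: `FormalHoffmanSpan ∧ Z ⇒ MzvSectorKernel` — the transfer needs A only through
`FormalHoffmanSpan`. [cite: Brown2012, Thm 1.1] -/
theorem mzvSectorKernel_of_formalHoffmanSpan (hF : FormalHoffmanSpan) (hZ : MzvPeriodConjecture) :
    MzvSectorKernel :=
  stub_sectorKernelOfFormalSpan hF hZ

/-- **JOINT SUFFICIENCY (no smuggled gap)**: A and O give the crux through the LANDED transfer T
(`stub_mzvSectorTransfer`); `MzvPeriodConjecture`, `PentagonInKZ`, `ReducedPeriodRing` are consumed by
T, the inner antecedents of `SectorToKernel` are not used. [folklore] -/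
theorem crux_of_stubs (hA : StubA) (hO : StubO) : KernelModuloPeriodConjecture :=
  fun hZ hP hR _ _ => hO (transfer hP hR hA hZ)

/-- The weaker sufficient pair: `FormalHoffmanSpan` and O already give the crux. [folklore] -/
theorem crux_of_formalHoffmanSpan (hF : FormalHoffmanSpan) (hO : StubO) : KernelModuloPeriodConjecture :=
  fun hZ _ _ _ _ => hO (mzvSectorKernel_of_formalHoffmanSpan hF hZ)

/-! ### Stub O -/

/-- The antecedent of O is summit-implied (it is a slice of the kernel form). [folklore] -/
theorem mzvSectorKernel_of_kernelForm (h : KernelForm) : MzvSectorKernel := fun c _ hc => h c hc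

/-- O is summit-implied. [folklore] -/
theorem stubO_of_summit (h : KontsevichZagierPeriods) : StubO := fun _ => kernelForm_iff_summit.mpr h

/-- **`¬O ↔ MzvSectorKernel ∧ ¬summit`**: O can only be killed by a disproof of Conjecture 1 whose
counterexample lives OFF the MZV sector while the sector kernel holds. [folklore] -/
theorem not_stubO_iff : ¬ StubO ↔ (MzvSectorKernel ∧ ¬ KontsevichZagierPeriods) := by
  rw [← kernelForm_iff_summit]
  constructor
  · intro h
    by_contra h'
    exact h fun hM => by_contra fun hK => h' ⟨hM, hK⟩
  · rintro ⟨hM, hK⟩ h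
    exact hK (h hM)

/-- Under A and the crux's three antecedents, O IS the conclusion (and the summit). [folklore] -/
theorem stubO_iff_of_stubA (hA : StubA) (hZ : MzvPeriodConjecture) (hP : PentagonInKZ)
    (hR : ReducedPeriodRing) : StubO ↔ KontsevichZagierPeriods :=
  ⟨fun hO => kernelForm_iff_summit.mp (hO (transfer hP hR hA hZ)), stubO_of_summit⟩

/-! ### The honest residual: formal Hoffman spanning is summit-implied given Brown's theorem -/

/-- **Every element of `P_ℚ = ℚ ⊗_ℤ P` is `(1/N) ⊗ p`** (common denominators). [folklore] -/
theorem exists_inv_nat_tmul (y : FormalPeriodAlgebra) :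
    ∃ (N : ℕ) (p : FormalPeriodRing), 0 < N ∧ y = ((1 : ℚ) / N) ⊗ₜ[ℤ] p := by
  induction y using TensorProduct.induction_on with
  | zero => exact ⟨1, 0, one_pos, by simp⟩
  | tmul q p =>
    refine ⟨q.den, q.num • p, q.den_pos, ?_⟩
    rw [← TensorProduct.smul_tmul, zsmul_eq_mul, mul_one_div, Rat.num_div_den]
  | add x y hx hy =>
    obtain ⟨N, p, hN, rfl⟩ := hx
    obtain ⟨M, p', hM, rfl⟩ := hy
    refine ⟨N * M, (M : ℤ) • p + (N : ℤ) • p', Nat.mul_pos hN hM, ?_⟩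
    rw [TensorProduct.tmul_add, ← TensorProduct.smul_tmul, ← TensorProduct.smul_tmul, zsmul_eq_mul,
      zsmul_eq_mul]
    have hN' : (N : ℚ) ≠ 0 := by exact_mod_cast hN.ne'
    have hM' : (M : ℚ) ≠ 0 := by exact_mod_cast hM.ne'
    congr 2
    · push_cast; field_simp
    · push_cast; field_simp

/-- **Under the kernel form, `evalPQ : P_ℚ → ℝ` is injective** (tree: `evalP` injective,
`kzKernelConjecture_iff_injective_evalP`). [folklore] -/
theorem evalPQ_injective_of_kernelForm (hK : KernelForm) : Function.Injective evalPQ := by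
  have hinj : Function.Injective evalP := kzKernelConjecture_iff_injective_evalP.mp hK
  rw [injective_iff_map_eq_zero]
  intro y hy
  obtain ⟨N, p, hN, rfl⟩ := exists_inv_nat_tmul y
  rw [evalPQ_tmul] at hy
  have hN' : ((1 : ℚ) / N : ℚ) ≠ 0 := by
    have : (N : ℚ) ≠ 0 := by exact_mod_cast hN.ne'
    exact one_div_ne_zero this
  have hp : evalP p = 0 := by
    rcases mul_eq_zero.mp hy with h | h
    · exact absurd (by exact_mod_cast h) hN'
    · exact h
  have hp0 : p = 0 := hinj (by rw [hp, map_zero])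
  rw [hp0, TensorProduct.tmul_zero]

/-- **`FormalHoffmanSpan` follows from the kernel form and Brown's theorem** (real form, the tree's
named fact `hoffmanSpan_eq_mzvSpace`): a real Hoffman expansion of `ζ(s)` lifts along the injective
`evalPQ`. So the intermediate the transfer consumes is SUMMIT-IMPLIED modulo a theorem in print, while A
is not (A ⇒ Brown, `hoffmanSpan_eq_mzvSpace_of_stubA` below). [cite: Brown2012, Thm 1.1] -/
theorem formalHoffmanSpan_of_kernelForm (hB : hoffmanSpan_eq_mzvSpace) (hK : KernelForm) :
    FormalHoffmanSpan := by
  intro s hs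
  set V : Submodule ℚ FormalPeriodAlgebra := Submodule.span ℚ (Set.range
    (fun t : {t : List ℕ // MZV.IsHoffman t} => toPeriodAlgebra (mzvClass t.1))) with hV
  have hζ : multipleZeta s ∈ hoffmanSpan (MZV.weight s) := by
    rw [hB]
    exact Submodule.subset_span ⟨s, hs, rfl, rfl⟩
  have hle : hoffmanSpan (MZV.weight s) ≤ V.map (evalPQ.toLinearMap) := by
    refine Submodule.span_le.mpr ?_
    rintro x ⟨t, ht, -, rfl⟩
    refine ⟨toPeriodAlgebra (mzvClass t), Submodule.subset_span ⟨⟨t, ht⟩, rfl⟩, ?_⟩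
    simp [evalP_mzvClass ht.isAdmissible]
  obtain ⟨v, hv, hveq⟩ := hle hζ
  have heq : toPeriodAlgebra (mzvClass s) = v := by
    refine evalPQ_injective_of_kernelForm hK ?_
    change evalPQ (toPeriodAlgebra (mzvClass s)) = evalPQ.toLinearMap v
    rw [hveq, evalPQ_toPeriodAlgebra, evalP_mzvClass hs]
  rw [heq]
  exact hv

/-- The same from the summit. [cite: Brown2012, Thm 1.1] -/
theorem formalHoffmanSpan_of_summit (hB : hoffmanSpan_eq_mzvSpace) (h : KontsevichZagierPeriods) :
    FormalHoffmanSpan :=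
  formalHoffmanSpan_of_kernelForm hB (kernelForm_iff_summit.mpr h)

/-! ### Stub A — hardness: A at `Φ_KZ` is Brown's spanning theorem -/

/-- A Hoffman index of weight `3` is `(3)`. [folklore] -/
theorem eq_three_of_isHoffman_of_weight {t : List ℕ} (ht : MZV.IsHoffman t) (hw : MZV.weight t = 3) :
    t = [3] := by
  match t, ht, hw with
  | [], _, hw => simp [MZV.weight] at hw
  | [a], ht, hw =>
    have : a = 3 := by simpa [MZV.weight] using hw
    subst this; rfl
  | a :: b :: u, ht, hw =>
    exfalso
    have ha := ht a (by simp)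
    have hb := ht b (by simp)
    have hw' : a + (b + u.sum) = 3 := by simpa [MZV.weight] using hw
    omega

/-! A Hoffman index of weight `4` is `(2,2)`: tree theorem `MZV.eq_of_isHoffman_of_weight_eq_four`. -/

/-- A `Finsupp.sum` whose support lies in `{t₀}` is the single term. [folklore] -/
theorem finsupp_sum_eq_of_support_subset {M : Type*} [AddCommMonoid M] {b : List ℕ →₀ ℚ}
    {t₀ : List ℕ} (hb : ∀ t ∈ b.support, t = t₀) (g : List ℕ → ℚ → M) (hg : g t₀ 0 = 0) :
    b.sum g = g t₀ (b t₀) := by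
  classical
  rw [Finsupp.sum_of_support_subset b (s := {t₀}) (fun t ht => Finset.mem_singleton.mpr (hb t ht))
    g (fun t ht => by rw [Finset.mem_singleton.mp ht]; exact hg)]
  exact Finset.sum_singleton _ _

/-- **A ⇒ Brown's spanning theorem for real MZVs.** Stub A evaluated at the Drinfeld associator
`Φ_KZ ∈ ℝ⟨⟨X₀,X₁⟩⟩` (group-like and a pentagon solution: tree theorems
`drinfeldAssociator_isGroupLike_holds`, `drinfeldAssociator_pentagon_holds`; convergent coefficients
`c_{binaryWord s}(Φ_KZ) = (−1)^{|s|} ζ(s)`, `drinfeldAssociator_binaryWord`) puts every `ζ(s)` in the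
`ℚ`-span of the Hoffman values of the same weight — the spanning half of [Brown 2012, Thm 1.1], the
tree's UNPROVED named fact `hoffmanSpan_eq_mzvSpace`. So any proof of A reproves Brown's theorem
(with one uniform certificate for all associators). [cite: Brown2012, Thm 1.1] -/
theorem multipleZeta_mem_hoffmanSpan_of_stubA (hA : StubA) {s : List ℕ} (hs : MZV.IsAdmissible s) :
    multipleZeta s ∈ hoffmanSpan (MZV.weight s) := by
  obtain ⟨b, hb, h⟩ := hA s hs
  have hΦ := h ℝ drinfeldAssociator drinfeldAssociator_isGroupLike_holds drinfeldAssociator_pentagon_holds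
  rw [drinfeldAssociator_binaryWord hs] at hΦ
  have hsum : b.sum (fun t q => q • drinfeldAssociator (MZV.binaryWord t)) ∈ hoffmanSpan (MZV.weight s) := by
    unfold Finsupp.sum
    refine Submodule.sum_mem _ fun t ht => ?_
    obtain ⟨hH, hw⟩ := hb t ht
    show b t • drinfeldAssociator (MZV.binaryWord t) ∈ hoffmanSpan (MZV.weight s)
    rw [drinfeldAssociator_binaryWord hH.isAdmissible]
    refine Submodule.smul_mem _ _ ?_
    have hmem : multipleZeta t ∈ hoffmanSpan (MZV.weight s) :=
      Submodule.subset_span ⟨t, hH, hw, rfl⟩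
    have : ((-1 : ℝ) ^ t.length * multipleZeta t) = ((-1 : ℤ) ^ t.length) • multipleZeta t := by
      simp [zsmul_eq_mul]
    rw [this]
    exact zsmul_mem hmem _
  have hζ : multipleZeta s = ((-1 : ℤ) ^ s.length) • b.sum (fun t q => q • drinfeldAssociator (MZV.binaryWord t)) := by
    rw [← hΦ, zsmul_eq_mul, Int.cast_pow, Int.cast_neg, Int.cast_one, ← mul_assoc, ← pow_add,
      ← two_mul, pow_mul]
    simp
  rw [hζ]
  exact zsmul_mem hsum _

/-- **A ⇒ the tree's named fact `hoffmanSpan_eq_mzvSpace`** (Brown 2012, Thm 1.1, spanning: unproved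
in the tree). [cite: Brown2012, Thm 1.1] -/
theorem hoffmanSpan_eq_mzvSpace_of_stubA (hA : StubA) : hoffmanSpan_eq_mzvSpace := by
  intro n
  refine le_antisymm (hoffmanSpan_le_mzvSpace n) (Submodule.span_le.mpr ?_)
  rintro x ⟨s, hs, hw, rfl⟩
  rw [← hw]
  exact multipleZeta_mem_hoffmanSpan_of_stubA hA hs

/-- Corollary: under A, `FormalHoffmanSpan` is summit-implied outright. [folklore] -/
theorem formalHoffmanSpan_of_stubA_of_summit (hA : StubA) (h : KontsevichZagierPeriods) :
    FormalHoffmanSpan :=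
  formalHoffmanSpan_of_summit (hoffmanSpan_eq_mzvSpace_of_stubA hA) h

/-! ### Stub A — mutation 1: the pentagon is load-bearing (weight 3 already) -/

/-- Stub A with the hypothesis `DrinfeldPentagon φ` DROPPED: Hoffman reduction for every group-like
series over every reduced commutative `ℚ`-algebra. -/
def StubAWithoutPentagon : Prop :=
  ∀ s : List ℕ, MZV.IsAdmissible s → ∃ b : List ℕ →₀ ℚ,
    (∀ t ∈ b.support, MZV.IsHoffman t ∧ MZV.weight t = MZV.weight s) ∧
    ∀ (R : Type) [CommRing R] [Algebra ℚ R] [IsReduced R] (φ : NCSeries Bool R),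
      NCSeries.IsGroupLike φ → φ (MZV.binaryWord s) = b.sum (fun t q => q • φ (MZV.binaryWord t))

/-- The two-parameter family of group-like series `exp(a X₀) exp(b X₁) ∈ ℚ⟨⟨X₀,X₁⟩⟩` (products of
exponentials of letters; group-like by `Shuffle.isGroupLike_expLetter` and `IsGroupLike.mul`). -/
abbrev expXexpY (a b : ℚ) : NCSeries Bool ℚ := Shuffle.expLetter false a * Shuffle.expLetter true b

/-- `exp(a X₀) exp(b X₁)` is group-like. [cite: Reutenauer1993, Thm 3.2] -/
theorem isGroupLike_expXexpY (a b : ℚ) : NCSeries.IsGroupLike (expXexpY a b) :=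
  (Shuffle.isGroupLike_expLetter false a).mul (Shuffle.isGroupLike_expLetter true b)

/-- `c_{X₀X₀X₁}(exp(aX₀)exp(bX₁)) = a²b/2`. [folklore] -/
theorem expXexpY_xxy (a b : ℚ) : expXexpY a b [false, false, true] = a ^ 2 / 2 * b := by
  simp [expXexpY, NCSeries.mul_apply_cons, NCSeries.mul_apply_nil', NCSeries.lderiv_apply,
    Shuffle.expLetter, List.replicate]
  left; ring

/-- `c_{X₀X₁X₁}(exp(aX₀)exp(bX₁)) = ab²/2`. [folklore] -/
theorem expXexpY_xyy (a b : ℚ) : expXexpY a b [false, true, true] = a * (b ^ 2 / 2) := by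
  simp [expXexpY, NCSeries.mul_apply_cons, NCSeries.mul_apply_nil', NCSeries.lderiv_apply,
    Shuffle.expLetter, List.replicate]
  left; ring

/-- **`stubA_false_without_pentagon`: the pentagon hypothesis of A is load-bearing.** At `s = (2,1)`
(weight 3, the only Hoffman index being `(3)`) A-without-pentagon asks for ONE rational `q` with
`c_{X₀X₁X₁}(φ) = q c_{X₀X₀X₁}(φ)` for all group-like `φ`; the group-like series `exp(X₀)exp(X₁)` and
`exp(X₀)exp(2X₁)` over `ℚ` force `q = 1` and `q = 2`. (For pentagon solutions `q = −1`, duality.)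
[folklore] -/
theorem stubA_false_without_pentagon : ¬ StubAWithoutPentagon := by
  intro h
  obtain ⟨b, hb, hφ⟩ := h [2, 1] ⟨by decide, by decide⟩
  have hsupp : ∀ t ∈ b.support, t = [3] := fun t ht =>
    eq_three_of_isHoffman_of_weight (hb t ht).1 (by simpa [MZV.weight] using (hb t ht).2)
  have key : ∀ φ : NCSeries Bool ℚ, NCSeries.IsGroupLike φ →
      φ [false, true, true] = b [3] * φ [false, false, true] := by
    intro φ hg
    have := hφ ℚ φ hg
    rw [finsupp_sum_eq_of_support_subset hsupp _ (by simp)] at this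
    simpa [MZV.binaryWord] using this
  have h₁ := key _ (isGroupLike_expXexpY 1 1)
  have h₂ := key _ (isGroupLike_expXexpY 1 2)
  rw [expXexpY_xxy, expXexpY_xyy] at h₁ h₂
  have hq : b [3] = 1 := by linarith
  rw [hq] at h₂
  norm_num at h₂

/-! ### Stub A — mutation 2: no integral certificates (the passage to `P_ℚ` in T is necessary) -/

/-- Stub A with INTEGER coefficients `b : List ℕ →₀ ℤ`. -/
def StubAIntegral : Prop :=
  ∀ s : List ℕ, MZV.IsAdmissible s → ∃ b : List ℕ →₀ ℤ,
    (∀ t ∈ b.support, MZV.IsHoffman t ∧ MZV.weight t = MZV.weight s) ∧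
    ∀ (R : Type) [CommRing R] [Algebra ℚ R] [IsReduced R] (φ : NCSeries Bool R),
      NCSeries.IsGroupLike φ → NCSeries.DrinfeldPentagon φ →
        φ (MZV.binaryWord s) = b.sum (fun t n => n • φ (MZV.binaryWord t))

/-- `c_{X₀X₁X₀X₁}(Φ_KZ) = ζ(2,2) > 0`. [cite: Furusho2003, Prop. 3.2.3] -/
theorem drinfeldAssociator_xyxy_pos : 0 < drinfeldAssociator [false, true, false, true] := by
  have hadm : MZV.IsAdmissible [2, 2] := ⟨by decide, by decide⟩
  have h := drinfeldAssociator_binaryWord hadm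
  have hw : MZV.binaryWord [2, 2] = [false, true, false, true] := by decide
  rw [hw] at h
  rw [h]
  have hpos := multipleZeta_pos_of_isAdmissible_holds hadm
  simpa using hpos

/-- `c_{X₀X₀X₀X₁}(Φ_KZ) = −ζ(4) ≠ 0`. [cite: Furusho2003, Prop. 3.2.3] -/
theorem drinfeldAssociator_xxxy_ne_zero : drinfeldAssociator [false, false, false, true] ≠ 0 := by
  have hadm : MZV.IsAdmissible [4] := ⟨by decide, by decide⟩
  have h := drinfeldAssociator_binaryWord hadm
  have hw : MZV.binaryWord [4] = [false, false, false, true] := by decide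
  rw [hw] at h
  rw [h]
  have hpos := multipleZeta_pos_of_isAdmissible_holds hadm
  simp only [List.length_singleton, pow_one, neg_mul, one_mul, ne_eq, neg_eq_zero]
  exact hpos.ne'

/-- **The pentagon in weight 4 at any group-like solution: `3 c_{X₀³X₁} = −4 c_{X₀X₁X₀X₁}`** (from the
tree's `DrinfeldPentagon.apply_weight_four'`; for `Φ_KZ`: `3ζ(4) = 4ζ(2,2)`). [cite: Furusho2010, §3] -/
theorem pentagon_weight_four_ratio {R : Type} [CommRing R] [Algebra ℚ R] {φ : NCSeries Bool R}
    (hg : NCSeries.IsGroupLike φ) (h5 : NCSeries.DrinfeldPentagon φ) :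
    3 * φ [false, false, false, true] = -4 * φ [false, true, false, true] := by
  have hx := h5.apply_letter_eq_zero_of_isGroupLike hg false
  have hy := h5.apply_letter_eq_zero_of_isGroupLike hg true
  obtain ⟨e1, -, e3, -⟩ := h5.apply_weight_four' hg.apply_nil hx hy
  have h15 : (15 : R) * φ [false, false, false, true] = -20 * φ [false, true, false, true] := by
    linear_combination 3 * e1 + 2 * e3
  have h5u : IsUnit (algebraMap ℚ R 5) := (IsUnit.mk0 (5 : ℚ) (by norm_num)).map _
  refine h5u.mul_left_cancel ?_
  rw [map_ofNat]
  linear_combination h15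

/-- **`not_stubAIntegral`: A has no integral form.** At `s = (4)` an integral certificate is one integer
`n` with `c_{X₀³X₁}(φ) = n c_{X₀X₁X₀X₁}(φ)` at every pentagon solution; the pentagon gives
`3 c_{X₀³X₁} = −4 c_{X₀X₁X₀X₁}`, so `(3n+4) c_{X₀X₁X₀X₁}(φ) = 0`; at `Φ_KZ ∈ ℝ⟨⟨X₀,X₁⟩⟩`,
`c_{X₀X₁X₀X₁} = ζ(2,2) > 0`, whence `3n + 4 = 0`, impossible in `ℤ`. Consequence for the line: the
`ℚ`-coefficients of A, the tensoring `P_ℚ = ℚ ⊗ P` in G1 and the proved `IntegerDivision` in G2 are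
NECESSARY. [folklore] -/
theorem not_stubAIntegral : ¬ StubAIntegral := by
  intro h
  obtain ⟨b, hb, hφ⟩ := h [4] ⟨by decide, by decide⟩
  have hsupp : ∀ t ∈ b.support, t = [2, 2] := fun t ht =>
    MZV.eq_of_isHoffman_of_weight_eq_four (hb t ht).1 (by simpa [MZV.weight] using (hb t ht).2)
  have hΦ := hφ ℝ drinfeldAssociator drinfeldAssociator_isGroupLike_holds drinfeldAssociator_pentagon_holds
  classical
  rw [Finsupp.sum_of_support_subset b (s := {[2, 2]})
      (fun t ht => Finset.mem_singleton.mpr (hsupp t ht)) _ (fun t _ => by simp),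
    Finset.sum_singleton] at hΦ
  have hw4 : MZV.binaryWord [4] = [false, false, false, true] := by decide
  have hw22 : MZV.binaryWord [2, 2] = [false, true, false, true] := by decide
  rw [hw4, hw22, zsmul_eq_mul] at hΦ
  have hpent := pentagon_weight_four_ratio drinfeldAssociator_isGroupLike_holds
    drinfeldAssociator_pentagon_holds
  have hpos := drinfeldAssociator_xyxy_pos
  -- (3 n + 4) ζ(2,2) = 0
  have hkey : ((3 : ℝ) * (b [2, 2] : ℝ) + 4) * drinfeldAssociator [false, true, false, true] = 0 := by
    linear_combination -3 * hΦ + hpent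
  have hn : (3 : ℝ) * (b [2, 2] : ℝ) + 4 = 0 := by
    rcases mul_eq_zero.mp hkey with h0 | h0
    · exact h0
    · exact absurd h0 hpos.ne'
  have hint : (3 : ℤ) * b [2, 2] + 4 = 0 := by exact_mod_cast hn
  omega

/-! ### Stub A — mutation 3: no depth-compatible certificates -/

/-- Stub A with the certificate supported on Hoffman indices of the same weight AND of depth at most
the depth of `s` (a depth-filtered Hoffman reduction). -/
def StubADepthCompatible : Prop :=
  ∀ s : List ℕ, MZV.IsAdmissible s → ∃ b : List ℕ →₀ ℚ,
    (∀ t ∈ b.support, MZV.IsHoffman t ∧ MZV.weight t = MZV.weight s ∧ MZV.depth t ≤ MZV.depth s) ∧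
    ∀ (R : Type) [CommRing R] [Algebra ℚ R] [IsReduced R] (φ : NCSeries Bool R),
      NCSeries.IsGroupLike φ → NCSeries.DrinfeldPentagon φ →
        φ (MZV.binaryWord s) = b.sum (fun t q => q • φ (MZV.binaryWord t))

/-- **`not_stubADepthCompatible`: Hoffman reduction cannot respect the depth filtration.** At
`s = (4)` (depth 1) the only weight-4 Hoffman index `(2,2)` has depth 2, so a depth-compatible
certificate is empty and would force `c_{X₀³X₁}(φ) = 0` at every pentagon solution — false at `Φ_KZ`
(`c_{X₀³X₁}(Φ_KZ) = −ζ(4) ≠ 0`). (Relevant to the depth-graded competitor idea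
`ls-depth-graded-squeeze`: Hoffman spanning is not a depth-graded statement.) [folklore] -/
theorem not_stubADepthCompatible : ¬ StubADepthCompatible := by
  intro h
  obtain ⟨b, hb, hφ⟩ := h [4] ⟨by decide, by decide⟩
  have hsupp : b.support = ∅ := by
    ext t
    simp only [Finset.notMem_empty, iff_false]
    intro ht
    obtain ⟨hH, hw, hd⟩ := hb t ht
    have := MZV.eq_of_isHoffman_of_weight_eq_four hH (by simpa [MZV.weight] using hw)
    subst this
    simp [MZV.depth] at hd
  have hb0 : b = 0 := Finsupp.support_eq_empty.mp hsupp
  have hΦ := hφ ℝ drinfeldAssociator drinfeldAssociator_isGroupLike_holds drinfeldAssociator_pentagon_holds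
  rw [hb0, Finsupp.sum_zero_index] at hΦ
  have hw4 : MZV.binaryWord [4] = [false, false, false, true] := by decide
  rw [hw4] at hΦ
  exact drinfeldAssociator_xxxy_ne_zero hΦ

/-- Division by a non-zero rational scalar in a `ℚ`-algebra: `n · x = m · y`, `n ≠ 0` gives
`x = (m/n) • y`. [folklore] -/
theorem eq_smul_of_mul_eq {R : Type} [CommRing R] [Algebra ℚ R] {n m : ℚ} (hn : n ≠ 0) {x y : R}
    (h : algebraMap ℚ R n * x = algebraMap ℚ R m * y) : x = (m / n) • y := by
  have hu : IsUnit (algebraMap ℚ R n) := (IsUnit.mk0 n hn).map _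
  refine hu.mul_left_cancel ?_
  rw [h, Algebra.smul_def, ← mul_assoc, ← map_mul, mul_div_cancel₀ m hn]

/-! ### Stub A — open mutations (no witness; recorded, not claimed) -/

/-- OPEN MUTATION: stub A over ALL commutative `ℚ`-algebras (drop `IsReduced R`). Status: unknown. A
witness would be a pentagon solution over a non-reduced ring (e.g. a first-order deformation
`Φ + ε D` over `ℝ[ε]/(ε²)`, `D` a Zariski tangent vector of `GroupLike ∩ Pent` at `Φ_KZ`) violating a
Hoffman reduction valid on reduced points — i.e. NON-REDUCEDNESS of Drinfeld's pentagon scheme in some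
weight; not in print either way. Note the tree's Furusho transfer
(`NCSeries.DrinfeldPentagon.generalisedDoubleShuffle`) already runs over every commutative `ℚ`-algebra,
so double shuffle gives no such witness. -/
def StubAWithoutReduced : Prop :=
  ∀ s : List ℕ, MZV.IsAdmissible s → ∃ b : List ℕ →₀ ℚ,
    (∀ t ∈ b.support, MZV.IsHoffman t ∧ MZV.weight t = MZV.weight s) ∧
    ∀ (R : Type) [CommRing R] [Algebra ℚ R] (φ : NCSeries Bool R),
      NCSeries.IsGroupLike φ → NCSeries.DrinfeldPentagon φ →
        φ (MZV.binaryWord s) = b.sum (fun t q => q • φ (MZV.binaryWord t))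

/-- `StubAWithoutReduced → StubA` (it is a strengthening). [folklore] -/
theorem stubA_of_withoutReduced (h : StubAWithoutReduced) : StubA := by
  intro s hs
  obtain ⟨b, hb, hφ⟩ := h s hs
  exact ⟨b, hb, fun R _ _ _ φ hg h5 => hφ R φ hg h5⟩

/-- In weight `≤ 4` the strengthening holds too (the tree certificate never uses reducedness). [folklore] -/
theorem stubAWithoutReduced_of_weight_le_four {s : List ℕ} (hs : MZV.IsAdmissible s)
    (hw : MZV.weight s ≤ 4) :
    ∃ b : List ℕ →₀ ℚ, (∀ t ∈ b.support, MZV.IsHoffman t ∧ MZV.weight t = MZV.weight s) ∧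
    ∀ (R : Type) [CommRing R] [Algebra ℚ R] (φ : NCSeries Bool R),
      NCSeries.IsGroupLike φ → NCSeries.DrinfeldPentagon φ →
        φ (MZV.binaryWord s) = b.sum (fun t q => q • φ (MZV.binaryWord t)) := by
  -- the weight-≤4 certificate of the tree is stated with `[IsReduced R]`; we re-derive the four
  -- non-Hoffman cases from the ring-level identities, and the Hoffman cases are `single s 1`.
  by_cases hH : MZV.IsHoffman s
  · refine ⟨Finsupp.single s 1, fun t ht => ?_, fun R _ _ φ _ _ => ?_⟩
    · classical
      rw [Finset.mem_singleton.mp (Finsupp.support_single_subset ht)]; exact ⟨hH, rfl⟩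
    · rw [Finsupp.sum_single_index (by simp), one_smul]
  · -- non-Hoffman admissible of weight ≤ 4: (2,1), (4), (3,1), (2,1,1); reduce to (3) resp. (2,2)
    obtain ⟨hpos, hhead⟩ := hs
    have key3 : ∀ (R : Type) [CommRing R] [Algebra ℚ R] (φ : NCSeries Bool R),
        NCSeries.IsGroupLike φ → NCSeries.DrinfeldPentagon φ →
          φ [false, true, true] = (-1 : ℚ) • φ [false, false, true] := by
      intro R _ _ φ hg h5
      have hx := h5.apply_letter_eq_zero_of_isGroupLike hg false
      have hy := h5.apply_letter_eq_zero_of_isGroupLike hg true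
      have h3 := h5.apply_weight_three hg.apply_nil hx hy
      rw [neg_smul, one_smul]
      linear_combination h3
    have key4 : ∀ (R : Type) [CommRing R] [Algebra ℚ R] (φ : NCSeries Bool R),
        NCSeries.IsGroupLike φ → NCSeries.DrinfeldPentagon φ →
          φ [false, false, false, true] = (-20 / 15 : ℚ) • φ [false, true, false, true] ∧
          φ [false, false, true, true] = (10 / 30 : ℚ) • φ [false, true, false, true] ∧
          φ [false, true, true, true] = (-20 / 15 : ℚ) • φ [false, true, false, true] := by
      intro R _ _ φ hg h5
      have hx := h5.apply_letter_eq_zero_of_isGroupLike hg false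
      have hy := h5.apply_letter_eq_zero_of_isGroupLike hg true
      obtain ⟨e1, e2, e3, e4⟩ := h5.apply_weight_four' hg.apply_nil hx hy
      refine ⟨eq_smul_of_mul_eq (by norm_num) ?_, eq_smul_of_mul_eq (by norm_num) ?_,
        eq_smul_of_mul_eq (by norm_num) ?_⟩
      · rw [map_neg, map_ofNat, map_ofNat]
        linear_combination 3 * e1 + 2 * e3
      · rw [map_ofNat, map_ofNat]
        linear_combination 3 * e2 - e3
      · rw [map_neg, map_ofNat, map_ofNat]
        linear_combination 3 * e4 + 2 * e3
    match s, hpos, hhead, hw, hH with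
    | [], _, _, _, hH => exact absurd (by simp [MZV.IsHoffman]) hH
    | [a], _, hhead, hw, hH =>
      have ha : 2 ≤ a := hhead (by simp)
      have ha' : a ≤ 4 := by simpa [MZV.weight] using hw
      interval_cases a
      · exact absurd (by decide) hH
      · exact absurd (by decide) hH
      · refine ⟨Finsupp.single [2, 2] (-20 / 15), fun t ht => ?_, fun R _ _ φ hg h5 => ?_⟩
        · classical
          rw [Finset.mem_singleton.mp (Finsupp.support_single_subset ht)]; exact ⟨by decide, rfl⟩
        · rw [Finsupp.sum_single_index (by simp)]
          exact (key4 R φ hg h5).1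
    | [a, b], hpos, hhead, hw, hH =>
      have ha : 2 ≤ a := hhead (by simp)
      have hb : 1 ≤ b := hpos b (by simp)
      have hw' : a + b ≤ 4 := by simpa [MZV.weight] using hw
      have ha' : a ≤ 3 := by omega
      have hb' : b ≤ 2 := by omega
      interval_cases a <;> interval_cases b
      · refine ⟨Finsupp.single [3] (-1), fun t ht => ?_, fun R _ _ φ hg h5 => ?_⟩
        · classical
          rw [Finset.mem_singleton.mp (Finsupp.support_single_subset ht)]; exact ⟨by decide, rfl⟩
        · rw [Finsupp.sum_single_index (by simp)]
          exact key3 R φ hg h5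
      · exact absurd (by decide) hH
      · refine ⟨Finsupp.single [2, 2] (10 / 30), fun t ht => ?_, fun R _ _ φ hg h5 => ?_⟩
        · classical
          rw [Finset.mem_singleton.mp (Finsupp.support_single_subset ht)]; exact ⟨by decide, rfl⟩
        · rw [Finsupp.sum_single_index (by simp)]
          exact (key4 R φ hg h5).2.1
      · omega
    | [a, b, c], hpos, hhead, hw, _ =>
      have ha : 2 ≤ a := hhead (by simp)
      have hb : 1 ≤ b := hpos b (by simp)
      have hc : 1 ≤ c := hpos c (by simp)
      have hw' : a + (b + c) ≤ 4 := by simpa [MZV.weight] using hw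
      obtain rfl : a = 2 := by omega
      obtain rfl : b = 1 := by omega
      obtain rfl : c = 1 := by omega
      refine ⟨Finsupp.single [2, 2] (-20 / 15), fun t ht => ?_, fun R _ _ φ hg h5 => ?_⟩
      · classical
        rw [Finset.mem_singleton.mp (Finsupp.support_single_subset ht)]; exact ⟨by decide, rfl⟩
      · rw [Finsupp.sum_single_index (by simp)]
        exact (key4 R φ hg h5).2.2
    | a :: b :: c :: d :: u, hpos, hhead, hw, _ =>
      exfalso
      have ha : 2 ≤ a := hhead (by simp)
      have hb : 1 ≤ b := hpos b (by simp)
      have hc : 1 ≤ c := hpos c (by simp)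
      have hd : 1 ≤ d := hpos d (by simp)
      have hw' : a + (b + (c + (d + u.sum))) ≤ 4 := by simpa [MZV.weight] using hw
      omega

/-- Consistency certificate: A holds for every admissible index of weight `≤ 4` (also in the tree, with
reducedness in the binder: `associatorHoffmanSpanning_of_weight_le_four`). [folklore] -/
theorem stubA_of_weight_le_four {s : List ℕ} (hs : MZV.IsAdmissible s) (hw : MZV.weight s ≤ 4) :
    ∃ b : List ℕ →₀ ℚ, (∀ t ∈ b.support, MZV.IsHoffman t ∧ MZV.weight t = MZV.weight s) ∧
    ∀ (R : Type) [CommRing R] [Algebra ℚ R] [IsReduced R] (φ : NCSeries Bool R),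
      NCSeries.IsGroupLike φ → NCSeries.DrinfeldPentagon φ →
        φ (MZV.binaryWord s) = b.sum (fun t q => q • φ (MZV.binaryWord t)) := by
  obtain ⟨b, hb, hφ⟩ := stubAWithoutReduced_of_weight_le_four hs hw
  exact ⟨b, hb, fun R _ _ _ φ hg h5 => hφ R φ hg h5⟩

/-- OPEN MUTATION: stub A for ALL pentagon solutions (drop `IsGroupLike φ`). Status: unknown; the only
non-group-like pentagon solutions over reduced rings found are the idempotent constants `φ = e`
(`e² = e`), which satisfy every homogeneous reduction trivially. -/
def StubAWithoutGroupLike : Prop :=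
  ∀ s : List ℕ, MZV.IsAdmissible s → ∃ b : List ℕ →₀ ℚ,
    (∀ t ∈ b.support, MZV.IsHoffman t ∧ MZV.weight t = MZV.weight s) ∧
    ∀ (R : Type) [CommRing R] [Algebra ℚ R] [IsReduced R] (φ : NCSeries Bool R),
      NCSeries.DrinfeldPentagon φ →
        φ (MZV.binaryWord s) = b.sum (fun t q => q • φ (MZV.binaryWord t))

/-- `StubAWithoutGroupLike → StubA`. [folklore] -/
theorem stubA_of_withoutGroupLike (h : StubAWithoutGroupLike) : StubA := by
  intro s hs
  obtain ⟨b, hb, hφ⟩ := h s hs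
  exact ⟨b, hb, fun R _ _ _ φ _ h5 => hφ R φ h5⟩

/-! ## §6 Transcendence positioning -/

/-- **The period conjecture for `MT(ℤ)` in Hoffman form implies `ζ(5) ∉ ℚ`** (tree weight-5 evaluation
`5ζ(5) = 4ζ(3,2) + 6ζ(2,3)`, `five_mul_multipleZeta_five`: a rational value `q` of `ζ(5)` is the
vanishing `ℚ`-combination `5q·ζ(∅) − 4ζ(3,2) − 6ζ(2,3)` of three Hoffman values). [cite: Brown2012, Thm 1.1] -/
theorem irrational_multipleZeta_five_of_mzvPeriodConjecture (hZ : MzvPeriodConjecture) :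
    Irrational (multipleZeta [5]) := by
  rintro ⟨q, hq⟩
  classical
  have h0 : MZV.IsHoffman [] := fun _ h => by simp at h
  have h32 : MZV.IsHoffman [3, 2] := by decide
  have h23 : MZV.IsHoffman [2, 3] := by decide
  let a : {u : List ℕ // MZV.IsHoffman u} := ⟨[], h0⟩
  let b : {u : List ℕ // MZV.IsHoffman u} := ⟨[3, 2], h32⟩
  let c : {u : List ℕ // MZV.IsHoffman u} := ⟨[2, 3], h23⟩
  have hab : a ≠ b := ne_of_apply_ne Subtype.val (show ([] : List ℕ) ≠ [3, 2] by decide)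
  have hac : a ≠ c := ne_of_apply_ne Subtype.val (show ([] : List ℕ) ≠ [2, 3] by decide)
  have hbc : b ≠ c := ne_of_apply_ne Subtype.val (show ([3, 2] : List ℕ) ≠ [2, 3] by decide)
  let g : {u : List ℕ // MZV.IsHoffman u} → ℚ := fun u =>
    if u.1 = [] then 5 * q else if u.1 = [3, 2] then -4 else if u.1 = [2, 3] then -6 else 0
  have hga : g a = 5 * q := by simp [g, a]
  have hgb : g b = -4 := by simp [g, b]
  have hgc : g c = -6 := by simp [g, c]
  have h5 := five_mul_multipleZeta_five
  have hsum : ∑ u ∈ ({a, b, c} : Finset {u : List ℕ // MZV.IsHoffman u}), g u • multipleZeta u.1 = 0 := by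
    rw [Finset.sum_insert (by simp [hab, hac]), Finset.sum_insert (by simp [hbc]), Finset.sum_singleton,
      hga, hgb, hgc]
    simp only [a, b, c, Rat.smul_def, multipleZeta_nil]
    push_cast
    rw [hq]
    linarith
  have hb0 : g b = 0 := linearIndependent_iff'.mp hZ {a, b, c} g hsum b (by simp)
  rw [hgb] at hb0
  norm_num at hb0

/-- **No refutation of the crux without `ζ(5) ∉ ℚ`.** [folklore] -/
theorem irrational_multipleZeta_five_of_not (h : ¬ KernelModuloPeriodConjecture) :
    Irrational (multipleZeta [5]) :=
  irrational_multipleZeta_five_of_mzvPeriodConjecture (mzvPeriodConjecture_of_not h)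

/-- A refutation hands over the MT(ℤ) period conjecture in Hoffman form: in particular the family of real
Hoffman values is `ℚ`-linearly independent, so e.g. `1, ζ(2), ζ(3), ζ(2,2), ζ(2,3), ζ(3,2), ζ(3,3), …`
admit no rational relation. Restated for the index: injectivity of `u ↦ ζ(u)` on Hoffman indices.
[folklore] -/
theorem hoffman_injective_of_not (h : ¬ KernelModuloPeriodConjecture) :
    Function.Injective (fun u : {u : List ℕ // MZV.IsHoffman u} => multipleZeta u.1) :=
  (mzvPeriodConjecture_of_not h).injective

end Summit.KontsevichZagierPeriods.KontsevichZagierPeriods.Cruxes.KernelModuloPeriodConjecture.Disproof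

end
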